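import Mathlib
import Literature.MathematicalPhysics.QuantumFieldTheory.Balaban1983to89.B6Prop23Chain
import Literature.MathematicalPhysics.QuantumFieldTheory.Balaban1983to89.B6Line4Member12

/-!
# `Balaban1983to89.B6Prop23Assembled` — pp. 237–238: the three per-term families of (2.82) DISCHARGED into the
assembly (2.85) ⇒ Proposition 2.3 (2.86)–(2.87): from the located cover∕kernel facts of pp. 229–237 (free constants)
to the existence, uniqueness and kernel bound of (Q′G′²Q′*)⁻¹ with every O(·) explicit — the node that
`…B6Prop23Chain` (hypotheses `hdiag`∕`hoff` of `mat_R282_abs_le`), `…B6Expansion282` (commutator family),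
`…B6Line4Member12`∕`…B6Ineq283` (family □ ≠ □′) and the change-of-domain modules list as the successor of the
lineage (B6 = T. Bałaban, *Propagators and renormalization transformations for lattice gauge theories. II*, Commun.
Math. Phys. **96**, 223–250 (1984) [Balaban1984PropagatorsII]).

CITATION HEADER (lean-in-tree rule 2026-08-18).  Cell `pub-balaban`, unit `b2b-balaban-b06-g12` (paper sub-cell B06,
gen 12 — the owner lineage of `…B6`, `…B6RandomWalk`, `…B6Ineq268`, `…B6Ineq283`, `…B6Expansion282`,
`…B6Prop23Chain`, `…B6Line4Member12`, `…B6DomainTerm282`, `…B6DomainMajorant[Sandwich]`).  Source: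
doi:10.1007/bf01240221, held `paper:balaban1984-cmp96-propagators-rt-ii`; journal page = PDF page + 222; the
quotations below were read from the page renders `b2b-balaban-ref1/pages/1984-cmp96-propagators-rt-II/1984-cmp96-
propagators-rt-II-p007-x2.png` (p. 229), `…-p013-x2.png` (p. 235), `…-p015-x2.png` (p. 237) and `…-p016-x2.png` (p. 238)
AS IMAGES (p. 238 re-read by gen 12 for this module).  Kernel twin of the hand certification GAPS C-adv4-40 (unit
b2b-balaban-adv4-g14, hostile second reading of (2.82)–(2.87): *"same mechanism as (2.64)–(2.66)"*); cell rows GAPS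
C-b06g12-2, DIVERGENCE D-b06.25; journal claim PROP23-ASSEMBLED.

THE PRINTED TEXT.  p. 229 [PDF 7], verbatim: *"We construct also the corresponding family of functions h described in
(1.118), and rescale them to proper scales. They satisfy Σ_{□∈𝒟} h_□² = 1. (2.36)"*.  p. 235 [PDF 13], verbatim:
*"⟨λ, λ′⟩ = Σ_{j=0}^k Σ_{y∈Λ_j} (L^jη)^d λ(y)λ′(y). (2.69)"* … *"C_□ = ((Q′G′(□̃)²Q′*)↾_□)⁻¹, C = Σ_{□∈𝒟} h_□C_□h_□.
(2.70)"*.  p. 237 [PDF 15], verbatim: *"|C_□(y, y′)| ≤ O(1)(L^jη)^{−d−4} e^{−δ₁(L^jη)^{−1}|y−y′|}, y, y′ ∈ 𝔅∩□. (2.81)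
Now we will proceed in the same way as in Sect. 5, (5.12)–(5.17) [3]. We will show that Q′G′²Q′*C is a good
approximation of identity. We have Q′G′²Q′*C = Σ_{□∈𝒟} Q′G′²Q′*h_□C_□h_□ = Σ_□ h_□(□Q′G′(□̃)²Q′*□)C_□h_□
− Σ_□ [h_□, □Q′G′(□̃)²Q′*□]C_□h_□ − Σ_□ □Q′(G′(□̃)² − G′²)Q′*h_□C_□h_□ − Σ_{□,□′≠□} (□ − 1)h²_{□′}Q′G′²Q′*h_□C_□h_□
= I − Σ_{□,□′} R_{□,□′}C_{□′}h_{□′} = I − R, (2.82) with an obvious definition of the operators R_{□,□′}. We have to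
estimate the norm of R in the space L²(𝔅). For example let us consider the operator R_{□,□′}C_{□′}h_{□′} with □ ≠ □′.
A kernel of this operator can be estimated as follows |(□′ − 1)(y)h²_□(y) Σ_{y″∈supp h_{□′}} (L^{j′}η)^d(Q′G′²Q′*)(y, y″)
h_{□′}(y″)C_{□′}(y″, y′)h_{□′}(y′)| ≤ … ≤ O(1) e^{−⅛δ₀M} e^{−δ₁d(y,y′)} (L^{j′}η)^{−d}, (2.83) where we have used the
fact that y ∉ □̃′, and all the properties of the distance d(·, ·)"* (members 2–5 typed in `…B6Ineq283`, member 1 ⇒ 2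
in `…B6Line4Member12`).  p. 238 [PDF 16], verbatim: *"so for M large enough the norm is small. Similar inequalities
hold for kernels of the other operators forming R, for example the operator with G′(□̃)² − G′² is small and an
estimate has the factor e^{−δ₀M} because of the usual estimate of the type (1.12) [3] connected with a change of a
domain. This estimate follows from the random walk representations (2.50) for the operators G′, G′(□̃). An estimate of
the terms with the commutator is even simpler and gives a factor O(M⁻¹). Now we can estimate the norm of R either
using the estimates of the type (2.84), or using an estimate of the kernel R(y, y′) of the operator R following from
all the partial estimates of the type (2.83). It can be written as |R(y, y′)| ≤ O(M⁻¹)e^{−δ₁d(y,y′)}(L^{j′}η)^{−d},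
y, y′ ∈ 𝔅, y′ ∈ Λ_{j′}, (2.85) and by Lemma 2.1 we get* **Proposition 2.3.** *An inverse of the operator Q′G′²Q′* is
given by the convergent expansion (Q′G′²Q′*)⁻¹ = C(I − R)⁻¹ = Σ_{n=0}^∞ CRⁿ = Σ_ω h_{□₀}C_{□₀}h_{□₀}R_{□₁,□₂}C_{□₂}h_{□₂}
·…·R_{□_{2n−1},□_{2n}}C_{□_{2n}}h_{□_{2n}}, (2.86) and it satisfies the estimate |(Q′G′²Q′*)⁻¹(y, y′)| ≤
O(1)(L^jη)^{−4}(L^{j′}η)^{−d}e^{−½δ₁d(y,y′)} y, y′ ∈ 𝔅, y ∈ Λ_j, y′ ∈ Λ_{j′}. (2.87)"*.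

THE TYPING (that of the siblings, nothing new).  Operators on L²(𝔅) are `Module.End ℝ (𝔅 → ℝ)` on the finite site
type of the abstract multiscale carrier `g : B6.Geometry` of `…B6` (𝔅 = `g.Site`, j = `g.scale`, d(·,·) = `g.dist`,
L^jη = `g.len`); `B6Expansion282.mulOp h` is multiplication by h, `kerOp w K` the operator with kernel K in the pairing
(2.69), weights w(y″) = (L^{j″}η)^d; `B6Prop23Chain.mat T y y′` = (L^{j′}η)^d·T(y, y′) is the matrix entry.  The cubes
□ ∈ 𝒟 are a finite index type D: □ = `mulOp (pf □)` ({0,1}-valued), h_□ = `mulOp (hf □)`, X = Q′G′²Q′* = `kerOp w X`,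
X̃_□ = Q′G′(□̃)²Q′* = `kerOp w (Xw □)`, C_□ = `kerOp w (Ck □)`; C = `Cglued`, R = `R282`, R_{□,□′} = `Rpair` of
`…B6Expansion282` (R_{□,□} = [h_□, □X̃_□□] + □(X̃_□ − X)h_□; R_{□,□′} = (□′ − 1)h_□²Xh_{□′} for □ ≠ □′).  The INPUTS are
the located facts of the siblings, as hypotheses of the printed shape with FREE constants (ABSOLUTE RULE: nothing is
cited as a fact): the cover — □ ∈ {0,1} (`hpf01`), □h_□ = h_□ (`hph`), (2.36) (`h236`), |h_□(y) − h_□(y″)| ≤ (s/M)d(y,y″)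
(`hLip`, the Lipschitz constant of (1.118)∕(2.35), GAPS C-b06g10-1 (r1)), at most n₀ of the h_□ non-zero at a site
(`hover`), every site of □ at scale j_□ or j_□ + 1 (`hcube`, *"a cube □ connected with a L^jη-scale"*), supp h_□ on ONE
level (`hlev` — the (2.83) typography "y″ ∈ Λ_{j′}" for all y″ ∈ supp h_{□′}; boundary cubes meeting two levels are NOT
covered by this typing, located), the gap m_g·M ≤ d(y, y″) for y ∉ □, y″ ∈ supp h_□ (`hgap`, *"the fact that y ∉ □̃′"*,
GAPS G-adv4-14), C_□(y″, ·) = 0 for y″ ∉ □ (`hCk0`, C_□ lives on □); the kernels — the (2.68)-type majorants of X and X̃_□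
at the rate ½δ₀ that (2.83) displays, weight included, |w(y″)X(y, y″)| ≤ B_X(L^jη)⁴e^{−½δ₀d(y,y″)} (`hX`, `hXw`; the
*"purely conventional"* choice of powers, p. 235; δ₀ is a FREE RATE NAME in this module — the printed (2.68) ends at the
rate ¼δ₀, so an instantiation from (2.68) takes this module's δ₀ := ½·(the printed δ₀), consistently in `hthr` and
`hsplit`, which are coupled to the same name), the change-of-domain majorant in the sandwiched form
|□(y)·w(y″)(X̃_□ − X)(y, y″)·h_□(y″)| ≤ B_D e^{−c₃M}(L^jη)⁴e^{−½δ₀d(y,y″)} (`hdom` — *"an estimate has the factor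
e^{−δ₀M}"*; this is the SHAPE of the output of `…B6DomainMajorantSandwich.line3_term_entry_le`, which however lives on
the fine lattice (blocks X → 𝔅, the operator □Q′(G′(□̃)² − G′²)Q′\*h_□) and decays at its own rate (δ − α′δ₀)∕6 with the
depth factor e^{−((δ−α′δ₀)∕3)M₀}: feeding it in — NOT done here — takes the relabelling δ₀ ↦ (δ − α′δ₀)∕3 of this module's
free δ₀ (then `hX`, `hXw`, `hthr`, `hsplit` at that δ₀ too), c₃M := ((δ − α′δ₀)∕3)M₀, and the kernel dictionary
`B9Thm34Inv.entry` = `B6Prop23Chain.mat`, X(y, y″) := mat(Q′G′²Q′\*)(y, y″)∕w(y″) (`B6Prop23Chain.mat_kerOp`); its own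
located inputs, incl. the printed (2.61), stay there), (2.81) on □ × □ with
d(y″, y′) for the straight contour, |C_□(y″, y′)| ≤ B_C(L^{j_□}η)^{−d−4}e^{−δ₁d(y″,y′)} (`h281`; (2.81) = (2.79) via
*"Sect. 5 [3]"*, GAPS G-B6-05; contour comparison located in `…B6Ineq283`), and (2.70) as the operator identity
(□X̃_□□)C_□h_□ = h_□ (`h270`); the geometry — (2.54) `Triangle254`, d ≥ 0, d(y, y) = 0, (2.60) in the metric form
`B6Ineq268.LevelSep`, RM ≥ 0, L ≥ 1, η > 0, M > 0, the rate split δ₁ + σδ₀ ≤ ¼δ₀ with (2.61) at α = σ and GENERIC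
constant c_σ, (2.61)∕(2.63) at the rate δ₁ (α = ½) with generic constant c (`B6Lemma21Repaired.Ineq261With`∕
`Ineq263With`; the printed c₁(α) is refuted as typed for d ≥ 3, GAPS G-A11-1), the threshold L⁴ ≤ e^{⅛δ₀RM} of (2.83)
member 4 ⇒ 5, and *"M large enough"* as M ≥ 2Kc with the explicit K = `K285`.

WHAT THIS MODULE PROVES (kernel-checked; no `sorry`, no axiom beyond Lean's three):
1. §1 `kerOp_sub_kerOp`, `locOp_kerOp`, `line3Ker`, `line3_operator_eq`, `line4Ker_mask` — kernel supplements: X̃_□ − X as one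
   kernel, □X̃_□□ as the kernel □(y)X̃_□(y,y″)□(y″), the term □(X̃_□ − X)h_□C_□h_□ of line 3 as a kernel operator, and the
   restriction of C_{□′} to supp h_{□′} inside the line-4 kernel (the printed Σ_{y″∈supp h_{□′}}).
2. §2 `ck_weighted_le` (+ four one-line cover facts) — (2.81) with the cube scale fact gives the weighted form
   |C_□(y″, y′)| ≤ (B_C L^{d+4})·(L^{j′}η)^{−d}·(L^{j′}η)^{−4}e^{−δ₁d(y″,y′)} that the siblings' chain lemmas consume
   (`B6Prop23Chain.scale_bookkeeping`).
3. §3 THE THREE FAMILIES AS MATRIX-ENTRY BOUNDS ε·e^{−δ₁d(y,y′)}, for ALL □ (□′) and ALL y, y′ (the vanishing cases —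
   y′ ∉ supp h, y ∉ □, y ∈ □′ — included): `commPiece_abs_le` (line 2, ε = κ₂/M, by `B6Expansion282.line2Ker_abs_le_285`:
   *"gives a factor O(M⁻¹)"*), `domPiece_abs_le` (line 3, ε = κ₃e^{−c₃M}, by `B6Ineq283.line2_le_line3` at D = 0 and the
   cube ratio (L^jη)⁴/(L^{j′}η)⁴ ≤ L⁴: *"has the factor e^{−δ₀M}"*), `offPiece_abs_le` (line 4, ε = κ₄e^{−⅛δ₀m_gM}, by
   `B6Line4Member12.line4Ker_abs_le_285` with D = d(y, supp h_{□′}) realised at a nearest support point: (2.83)).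
4. §4 `mat_diag_abs_le`, `mat_off_abs_le` — the hypotheses `hdiag`, `hoff` of `B6Prop23Chain.mat_R282_abs_le` DISCHARGED
   (operator ↦ kernel by `Rpair_self`∕`Rpair_ne`, `line2_operator_eq`, `line3_operator_eq`, `line4_operator_eq`,
   `mat_kerOp`); `mat_R_abs_le` — (2.85) |mat R y y′| ≤ θe^{−δ₁d(y,y′)} with θ = `theta285` =
   n₀(κ₂/M + κ₃e^{−c₃M}) + n₀²κ₄e^{−(⅛δ₀m_g)M}; `theta285_le` — θ ≤ K/M, the printed *"O(M⁻¹)"*;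
   `prop23_assembled` — PROPOSITION 2.3: under the inputs above and M ≥ 2Kc, X = Q′G′²Q′* has a unique two-sided inverse
   G on L²(𝔅), G = C + GR (= C(I − R)⁻¹ = Σ CRⁿ, (2.86); `B6Expansion282.expansion282` gives X·C = I − R,
   `B6Prop23Chain.prop23_kernel_287` the Neumann∕Lemma 2.1 step and `mat_Cglued_abs_le` the majorant of C), and
   *"|(Q′G′²Q′*)⁻¹(y, y′)| ≤ O(1)(L^jη)^{−4}(L^{j′}η)^{−d}e^{−½δ₁d(y,y′)}"* (2.87) with O(1) = 2n₀B_C L^{d+4}c.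
5. §5 `ptGeo`, `ptGeo_nonvacuous` — CONSISTENCY: on the one-point one-cube model every hypothesis of `prop23_assembled`
   is discharged (the theorem is applied there), so the hypothesis package is not contradictory.
WHAT IT DOES NOT PROVE: any of the INPUTS listed under THE TYPING — they keep exactly the located status they have in
the siblings (in particular the majorants of Q′G′²Q′* and Q′G′(□̃)²Q′* from (2.50)∕(2.68), the change-of-domain
majorant with its e^{−c₃M} (`…B6DomainMajorantSandwich` under ITS hypotheses — not imported here, its fine-lattice
binders are replaced by the kernel-form hypothesis `hdom`), (2.81), the Lipschitz constant s, the overlap number n₀,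
the single-level support typing, the gap m_g, (2.60)∕(2.61)∕(2.63) for the realised geometry); positive definiteness of
Q′G′²Q′* (not needed on the finite set); the path form Σ_ω of (2.86) (only G = C + GR ∕ Σ CRⁿ is used); the L²-norm
route (2.84).  Value = kernel certificate that the printed proof of Proposition 2.3 composes — the per-term estimates
of (2.82), the counting (2.85) and Lemma 2.1 fit together with explicit constants and no hidden hypothesis beyond the
listed located inputs — NOT summit progress.  SCOPE CAVEATS for downstream citation as "Prop. 2.3": single-level
supports only (`hlev`; the printed statement covers cubes meeting two levels), and `ptGeo_nonvacuous` certifies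
consistency on a degenerate model (B_D = 0, δ₁ = 0, □ ≡ 1), not joint satisfiability on a multi-cube two-level
geometry.  (v1.1: docstrings only — the rate-name clauses for `hX`∕`hdom` and these caveats; declarations unchanged.)
-/

namespace Literature.MathematicalPhysics.QuantumFieldTheory.Balaban1983to89.B6Prop23Assembled

open Literature.MathematicalPhysics.QuantumFieldTheory.Balaban1983to89
open Finset B6RandomWalk B6Lemma21Repaired B6Expansion282 B6Ineq283 B6Prop23Chain B6Line4Member12

/-! ## §1. Kernel supplements: differences, localized kernel operators, the domain-term kernel -/

section Kernels

variable {S : Type} [Fintype S]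

/-- Kernel operators subtract kernelwise: K_w(A) − K_w(B) = K_w(A − B) (X̃_□ − X as one kernel). [folklore] -/
theorem kerOp_sub_kerOp (w : S → ℝ) (A B : S → S → ℝ) :
    kerOp w A - kerOp w B = kerOp w (fun y y'' => A y y'' - B y y'') := by
  refine LinearMap.ext fun μ => funext fun y => ?_
  simp only [LinearMap.sub_apply, Pi.sub_apply, kerOp_apply, ← Finset.sum_sub_distrib]
  exact Finset.sum_congr rfl fun _ _ => by ring

/-- The localized operator □X̃_□□ = `locOp` of a kernel operator is the kernel operator with kernel
□(y)X̃_□(y, y″)□(y″). [cite: Balaban1984PropagatorsII, (2.82) p.237] -/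
theorem locOp_kerOp {D : Type} (w : S → ℝ) (p : D → S → ℝ) (K : D → S → S → ℝ) (i : D) :
    locOp (fun i => mulOp (p i)) (fun i => kerOp w (K i)) i =
      kerOp w (fun y y'' => p i y * K i y y'' * p i y'') := by
  unfold locOp
  rw [mulOp_mul_kerOp, kerOp_mul_mulOp]

/-- The kernel of ONE TERM OF LINE 3 of (2.82), □(X̃_□ − X)h_□C_□h_□, in the pairing (2.69):
(y, y′) ↦ □(y)·(Σ_{y″} w(y″) Y(y, y″) h_□(y″) C_□(y″, y′))·h_□(y′) with Y = X̃_□ − X.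
[cite: Balaban1984PropagatorsII, (2.82) line 3 p.237] -/
def line3Ker (w p h : S → ℝ) (Y C : S → S → ℝ) : S → S → ℝ :=
  fun y y' => p y * (∑ y'', w y'' * Y y y'' * h y'' * C y'' y') * h y'

/-- **The line-3 term is a kernel operator**: □·K_w(Y)·h_□·K_w(C)·h_□ = K_w(`line3Ker w □ h Y C`).
[cite: Balaban1984PropagatorsII, (2.82) line 3 p.237] -/
theorem line3_operator_eq (w p h : S → ℝ) (Y C : S → S → ℝ) :
    mulOp p * kerOp w Y * mulOp h * kerOp w C * mulOp h = kerOp w (line3Ker w p h Y C) := by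
  rw [mulOp_mul_kerOp, kerOp_mul_mulOp, kerOp_mul_kerOp, kerOp_mul_mulOp]
  congr 1
  funext y y'
  simp only [compKer, line3Ker, Finset.sum_mul, Finset.mul_sum]
  exact Finset.sum_congr rfl fun y'' _ => by ring

/-- MASKING: in `line4Ker` the kernel C(y″, y′) only matters where h_{□′}(y″) ≠ 0, so C_{□′} may be replaced by its
restriction to supp h_{□′} (the printed *"Σ_{y″∈supp h_{□′}}"*). [cite: Balaban1984PropagatorsII, (2.83) p.237] -/
theorem line4Ker_mask (w p' h h' : S → ℝ) (X C : S → S → ℝ) (y y' : S) :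
    line4Ker w p' h h' X C y y' = line4Ker w p' h h' X (fun y'' z => if h' y'' = 0 then 0 else C y'' z) y y' := by
  have hs : (∑ y'', w y'' * X y y'' * h' y'' * C y'' y') =
      ∑ y'', w y'' * X y y'' * h' y'' * (if h' y'' = 0 then 0 else C y'' y') := by
    refine Finset.sum_congr rfl fun y'' _ => ?_
    by_cases h0 : h' y'' = 0
    · rw [if_pos h0, h0]; ring
    · rw [if_neg h0]
  unfold line4Ker
  rw [hs]

end Kernels

/-! ## §2. Cover facts ⟹ the elementary pointwise consequences used below -/

section CoverFacts

variable {g : B6.Geometry} {D : Type}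

/-- A {0,1}-valued □ has |□(y)| ≤ 1. [folklore] -/
theorem abs_pf_le_one {pf : D → g.Site → ℝ} (hpf01 : ∀ i y, pf i y = 0 ∨ pf i y = 1) (i : D) (y : g.Site) :
    |pf i y| ≤ 1 := by
  rcases hpf01 i y with h | h <;> simp [h]

/-- … and |□(y) − 1| ≤ 1. [folklore] -/
theorem abs_pf_sub_one_le_one {pf : D → g.Site → ℝ} (hpf01 : ∀ i y, pf i y = 0 ∨ pf i y = 1) (i : D)
    (y : g.Site) : |pf i y - 1| ≤ 1 := by
  rcases hpf01 i y with h | h <;> simp [h]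

/-- □h_□ = h_□ (supp h_□ ⊂ □): where h_□ ≠ 0 the characteristic function is ≠ 0. [cite: Balaban1984PropagatorsII, (2.36) p.229] -/
theorem pf_ne_zero_of_hf_ne_zero {pf hf : D → g.Site → ℝ} (hph : ∀ i y, pf i y * hf i y = hf i y) {i : D}
    {y : g.Site} (h : hf i y ≠ 0) : pf i y ≠ 0 := by
  intro h0
  have := hph i y
  rw [h0, zero_mul] at this
  exact h this.symm

/-- Σ_□ h_□(y)² = 1 ⟹ |h_□(y)| ≤ 1. [cite: Balaban1984PropagatorsII, (2.36) p.229] -/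
theorem abs_hf_le_one [Fintype D] {hf : D → g.Site → ℝ} (h236 : ∀ y, ∑ i, hf i y ^ 2 = 1) (i : D) (y : g.Site) :
    |hf i y| ≤ 1 := by
  have hle : hf i y ^ 2 ≤ 1 := by
    calc hf i y ^ 2 ≤ ∑ i', hf i' y ^ 2 :=
          Finset.single_le_sum (fun i' _ => sq_nonneg (hf i' y)) (Finset.mem_univ i)
      _ = 1 := h236 y
  exact abs_le_one_iff_mul_self_le_one.mpr (by nlinarith [hle])

/-- **(2.81) IN THE WEIGHTED FORM THE SIBLINGS CONSUME.**  From (2.81) on □ × □ as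
|C_□(y″, y′)| ≤ B_C (L^{j_□}η)^{−d−4} e^{−δ₁d(y″,y′)} and the cube scale fact scale(y′) ≤ j_□ + 1 on □:
|C_□(y″, y′)| ≤ (B_C L^{d+4})·P(y′)·(L^{j′}η)^{−4}·e^{−δ₁d(y″,y′)} with P(y′) = (L^{j′}η)^{−d} — the `hC` hypothesis of
`B6Expansion282.line2Ker_abs_le_285` ∕ `B6Line4Member12.line4Ker_abs_le_285` (power bookkeeping
`B6Prop23Chain.scale_bookkeeping`). [cite: Balaban1984PropagatorsII, (2.81) p.237] -/
theorem ck_weighted_le (d : ℕ) (hL : 1 ≤ g.L) (hη : 0 < g.eta) {BC δ₁ : ℝ} (hBC : 0 ≤ BC)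
    {pf : D → g.Site → ℝ} {js : D → ℕ} {Ck : D → g.Site → g.Site → ℝ}
    (hcube : ∀ i y, pf i y ≠ 0 → js i ≤ g.scale y ∧ g.scale y ≤ js i + 1)
    (h281 : ∀ i y y', pf i y ≠ 0 → pf i y' ≠ 0 →
      |Ck i y y'| ≤ BC / (g.L ^ js i * g.eta) ^ (d + 4) * Real.exp (-(δ₁ * g.dist y y')))
    {i : D} {y'' y' : g.Site} (hy'' : pf i y'' ≠ 0) (hy' : pf i y' ≠ 0) :
    |Ck i y'' y'| ≤ BC * g.L ^ (d + 4) * (g.len y' ^ d)⁻¹ / g.len y' ^ 4 * Real.exp (-(δ₁ * g.dist y'' y')) := by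
  have hL0 : 0 < g.L := zero_lt_one.trans_le hL
  have hlen : 0 < g.len y' := mul_pos (pow_pos hL0 _) hη
  have hb : 0 < g.L ^ js i * g.eta := mul_pos (pow_pos hL0 _) hη
  have hsc : g.scale y' ≤ js i + 1 := (hcube i y' hy').2
  have hbook := scale_bookkeeping d hb hlen.le hlen (len_le_of_scale_le hL hη.le hsc)
    (len_le_of_scale_le hL hη.le hsc)
  have hd0 : 0 < g.len y' ^ d := pow_pos hlen d
  have hcoef : BC / (g.L ^ js i * g.eta) ^ (d + 4) ≤ BC * g.L ^ (d + 4) * (g.len y' ^ d)⁻¹ / g.len y' ^ 4 :=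
    calc BC / (g.L ^ js i * g.eta) ^ (d + 4)
        = BC * (g.len y' ^ d / (g.L ^ js i * g.eta) ^ (d + 4)) * (g.len y' ^ d)⁻¹ := by
          field_simp
      _ ≤ BC * (g.L ^ (d + 4) / g.len y' ^ 4) * (g.len y' ^ d)⁻¹ :=
          mul_le_mul_of_nonneg_right (mul_le_mul_of_nonneg_left hbook hBC) (inv_nonneg.mpr hd0.le)
      _ = BC * g.L ^ (d + 4) * (g.len y' ^ d)⁻¹ / g.len y' ^ 4 := by ring
  exact (h281 i y'' y' hy'' hy').trans (mul_le_mul_of_nonneg_right hcoef (Real.exp_pos _).le)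

/-- Two sites of one cube □ have scales differing by at most one (both in {j_□, j_□ + 1}). [cite: Balaban1984PropagatorsII, (2.70) p.235] -/
theorem scale_le_of_cube {pf : D → g.Site → ℝ} {js : D → ℕ}
    (hcube : ∀ i y, pf i y ≠ 0 → js i ≤ g.scale y ∧ g.scale y ≤ js i + 1) {i : D} {y y' : g.Site}
    (hy : pf i y ≠ 0) (hy' : pf i y' ≠ 0) : g.scale y ≤ g.scale y' + 1 :=
  (hcube i y hy).2.trans (Nat.add_le_add_right (hcube i y' hy').1 1)

end CoverFacts

/-! ## §3. The three per-term families of (2.82) in the (2.85) shape ε·e^{−δ₁d(y,y′)} (matrix entries) -/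

section Pieces

variable {g : B6.Geometry} {D : Type}

/-- **LINE 2 (COMMUTATOR FAMILY), weighted entry.**  For every cube □ and all y, y′ ∈ 𝔅:
|(L^{j′}η)^d · ([h_□, □X̃_□□]C_□h_□)(y, y′)| ≤ M⁻¹·(s B_X (B_C L^{d+4}) L⁴ c_σ ∕(e·¼δ₀))·e^{−δ₁d(y,y′)} — by
`B6Expansion282.line2Ker_abs_le_285` (a = ½, b = ¼) once the row y lies in □ and the column y′ in supp h_□ (else the
kernel vanishes: □(y) = 0 kills X̃'s localized kernel, h_□(y′) = 0 the last factor).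
[cite: Balaban1984PropagatorsII, (2.82) line 2 + «gives a factor O(M⁻¹)» p.238] -/
theorem commPiece_abs_le (htri : Triangle254 g) (hd : ∀ a b : g.Site, 0 ≤ g.dist a b) (hL : 1 ≤ g.L)
    (hη : 0 < g.eta) {δ₀ δ₁ σ cσ s BX BC : ℝ} (hδ₀ : 0 < δ₀) (hδ₁ : 0 ≤ δ₁) (hsplit : δ₁ + σ * δ₀ ≤ δ₀ / 4)
    (h261σ : Ineq261With cσ g δ₀ σ) (hs : 0 ≤ s) (hM : 0 < g.M) (hBX : 0 ≤ BX) (hBC : 0 ≤ BC) (d : ℕ)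
    {pf hf : D → g.Site → ℝ} {js : D → ℕ} {Xw Ck : D → g.Site → g.Site → ℝ}
    (hpf01 : ∀ i y, pf i y = 0 ∨ pf i y = 1) (hph : ∀ i y, pf i y * hf i y = hf i y)
    (hh1 : ∀ i y, |hf i y| ≤ 1) (hLip : ∀ i y y'', |hf i y - hf i y''| ≤ s / g.M * g.dist y y'')
    (hcube : ∀ i y, pf i y ≠ 0 → js i ≤ g.scale y ∧ g.scale y ≤ js i + 1)
    (hXw : ∀ i y y'', |g.len y'' ^ d * Xw i y y''| ≤ BX * g.len y ^ 4 * Real.exp (-(1 / 2 * δ₀ * g.dist y y'')))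
    (h281 : ∀ i y y', pf i y ≠ 0 → pf i y' ≠ 0 →
      |Ck i y y'| ≤ BC / (g.L ^ js i * g.eta) ^ (d + 4) * Real.exp (-(δ₁ * g.dist y y')))
    (hCk0 : ∀ i y'' y', pf i y'' = 0 → Ck i y'' y' = 0) (i : D) (y y' : g.Site) :
    |g.len y' ^ d * line2Ker (fun z => g.len z ^ d) (hf i) (fun y y'' => pf i y * Xw i y y'' * pf i y'') (Ck i) y y'|
      ≤ 1 / g.M * (s * BX * (BC * g.L ^ (d + 4)) * g.L ^ 4 * cσ / (Real.exp 1 * (1 / 4 * δ₀))) *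
        Real.exp (-(δ₁ * g.dist y y')) := by
  classical
  have hL0 : 0 < g.L := zero_lt_one.trans_le hL
  have hlen : ∀ z : g.Site, 0 < g.len z := fun z => mul_pos (pow_pos hL0 _) hη
  have hc0 : 0 ≤ cσ := c_nonneg_of_ineq261With h261σ y
  have hRHS : 0 ≤ 1 / g.M * (s * BX * (BC * g.L ^ (d + 4)) * g.L ^ 4 * cσ / (Real.exp 1 * (1 / 4 * δ₀))) *
      Real.exp (-(δ₁ * g.dist y y')) := by positivity
  set w : g.Site → ℝ := fun z => g.len z ^ d with hw
  set X' : g.Site → g.Site → ℝ := fun y y'' => pf i y * Xw i y y'' * pf i y'' with hX'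
  by_cases hy' : hf i y' = 0
  · -- the column factor h_□(y′) vanishes
    have : line2Ker w (hf i) X' (Ck i) y y' = 0 := by unfold line2Ker; rw [hy', mul_zero]
    rw [this, mul_zero, abs_zero]; exact hRHS
  by_cases hy : pf i y = 0
  · -- the row y lies outside □: the localized kernel vanishes
    have : line2Ker w (hf i) X' (Ck i) y y' = 0 := by
      unfold line2Ker compKer commKer
      rw [Finset.sum_eq_zero fun y'' _ => by rw [hX']; simp only [hy, zero_mul, mul_zero], zero_mul]
    rw [this, mul_zero, abs_zero]; exact hRHS
  have hpy' : pf i y' ≠ 0 := pf_ne_zero_of_hf_ne_zero hph hy'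
  have hsc : g.scale y ≤ g.scale y' + 1 := scale_le_of_cube hcube hy hpy'
  have hsplit' : δ₁ + σ * δ₀ + 1 / 4 * δ₀ ≤ 1 / 2 * δ₀ := by linarith
  set S' : Finset g.Site := Finset.univ.filter fun y'' => pf i y'' ≠ 0 with hS'
  have hXb : ∀ y'', |w y'' * X' y y''| ≤ BX * g.len y ^ 4 * Real.exp (-(1 / 2 * δ₀ * g.dist y y'')) := by
    intro y''
    have e : w y'' * X' y y'' = pf i y * (g.len y'' ^ d * Xw i y y'') * pf i y'' := by rw [hw, hX']; ring
    rw [e, abs_mul, abs_mul]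
    have hA := hXw i y y''
    calc |pf i y| * |g.len y'' ^ d * Xw i y y''| * |pf i y''| ≤ 1 * (BX * g.len y ^ 4 *
          Real.exp (-(1 / 2 * δ₀ * g.dist y y''))) * 1 :=
          mul_le_mul (mul_le_mul (abs_pf_le_one hpf01 i y) hA (abs_nonneg _) zero_le_one)
            (abs_pf_le_one hpf01 i y'') (abs_nonneg _) (mul_nonneg zero_le_one ((abs_nonneg _).trans hA))
      _ = BX * g.len y ^ 4 * Real.exp (-(1 / 2 * δ₀ * g.dist y y'')) := by ring
  have hCb : ∀ y'' ∈ S', |Ck i y'' y'| ≤ BC * g.L ^ (d + 4) * (g.len y' ^ d)⁻¹ / g.len y' ^ 4 *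
      Real.exp (-(δ₁ * g.dist y'' y')) := by
    intro y'' hy''
    have hpy'' : pf i y'' ≠ 0 := (Finset.mem_filter.mp hy'').2
    exact ck_weighted_le d hL hη hBC hcube h281 hpy'' hpy'
  have hC0 : ∀ y'', y'' ∉ S' → Ck i y'' y' = 0 := by
    intro y'' hy''
    have : ¬ pf i y'' ≠ 0 := fun h => hy'' (Finset.mem_filter.mpr ⟨Finset.mem_univ _, h⟩)
    exact hCk0 i y'' y' (not_not.mp this)
  have hmain := line2Ker_abs_le_285 htri hd hL hη hδ₀ hδ₁ (by norm_num : (0 : ℝ) < 1 / 4) hsplit' h261σ hs hM hBX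
    (by positivity : 0 ≤ BC * g.L ^ (d + 4)) (P := fun z => (g.len z ^ d)⁻¹)
    (fun z => inv_nonneg.mpr (pow_nonneg (hlen z).le d)) (ρ := fun y'' => g.dist y'' y') hsc hXb hCb hC0
    (fun y'' _ => le_rfl) (hLip i y) (hh1 i y')
  have hwP : g.len y' ^ d * (g.len y' ^ d)⁻¹ = 1 := mul_inv_cancel₀ (pow_pos (hlen y') d).ne'
  rw [abs_mul, abs_of_pos (pow_pos (hlen y') d)]
  calc g.len y' ^ d * |line2Ker w (hf i) X' (Ck i) y y'|
      ≤ g.len y' ^ d * (1 / g.M * (s * BX * (BC * g.L ^ (d + 4)) * g.L ^ 4 * cσ / (Real.exp 1 * (1 / 4 * δ₀))) *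
          Real.exp (-(δ₁ * g.dist y y')) * (g.len y' ^ d)⁻¹) :=
        mul_le_mul_of_nonneg_left hmain (pow_nonneg (hlen y').le d)
    _ = 1 / g.M * (s * BX * (BC * g.L ^ (d + 4)) * g.L ^ 4 * cσ / (Real.exp 1 * (1 / 4 * δ₀))) *
          Real.exp (-(δ₁ * g.dist y y')) * (g.len y' ^ d * (g.len y' ^ d)⁻¹) := by ring
    _ = _ := by rw [hwP, mul_one]

/-- **LINE 3 (CHANGE-OF-DOMAIN FAMILY), weighted entry.**  With the domain-change majorant in the MASKED kernel form
|□(y)·w(y″)(X̃_□ − X)(y, y″)·h_□(y″)| ≤ B_D e^{−c₃M}(L^jη)⁴e^{−½δ₀d(y,y″)} (the shape of the output of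
`…B6DomainMajorantSandwich.line3_term_entry_le` up to the rate relabelling δ₀ ↦ (δ − α′δ₀)∕3 and the fine-lattice-to-𝔅
kernel dictionary recorded in the header — *"an estimate has the factor e^{−δ₀M}"*), (2.81) and the cube facts:
|(L^{j′}η)^d · (□(X̃_□ − X)h_□C_□h_□)(y, y′)| ≤ (B_D (B_C L^{d+4}) c_σ L⁴ e^{−c₃M})·e^{−δ₁d(y,y′)}.
[cite: Balaban1984PropagatorsII, (2.82) line 3 p.237 + «the factor e^{−δ₀M}» p.238] -/
theorem domPiece_abs_le (htri : Triangle254 g) (hd : ∀ a b : g.Site, 0 ≤ g.dist a b) (hL : 1 ≤ g.L)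
    (hη : 0 < g.eta) {δ₀ δ₁ σ cσ c₃ BD BC : ℝ} (hδ₀ : 0 < δ₀) (hδ₁ : 0 ≤ δ₁) (hsplit : δ₁ + σ * δ₀ ≤ δ₀ / 4)
    (h261σ : Ineq261With cσ g δ₀ σ) (hBD : 0 ≤ BD) (hBC : 0 ≤ BC) (d : ℕ)
    {pf hf : D → g.Site → ℝ} {js : D → ℕ} {X : g.Site → g.Site → ℝ} {Xw Ck : D → g.Site → g.Site → ℝ}
    (hph : ∀ i y, pf i y * hf i y = hf i y) (hh1 : ∀ i y, |hf i y| ≤ 1)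
    (hcube : ∀ i y, pf i y ≠ 0 → js i ≤ g.scale y ∧ g.scale y ≤ js i + 1)
    (hdom : ∀ i y y'', |pf i y * (g.len y'' ^ d * (Xw i y y'' - X y y'')) * hf i y''| ≤
      BD * Real.exp (-(c₃ * g.M)) * g.len y ^ 4 * Real.exp (-(1 / 2 * δ₀ * g.dist y y'')))
    (h281 : ∀ i y y', pf i y ≠ 0 → pf i y' ≠ 0 →
      |Ck i y y'| ≤ BC / (g.L ^ js i * g.eta) ^ (d + 4) * Real.exp (-(δ₁ * g.dist y y')))
    (hCk0 : ∀ i y'' y', pf i y'' = 0 → Ck i y'' y' = 0) (i : D) (y y' : g.Site) :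
    |g.len y' ^ d * line3Ker (fun z => g.len z ^ d) (pf i) (hf i) (fun y y'' => Xw i y y'' - X y y'') (Ck i) y y'|
      ≤ (BD * (BC * g.L ^ (d + 4)) * cσ * g.L ^ 4 * Real.exp (-(c₃ * g.M))) * Real.exp (-(δ₁ * g.dist y y')) := by
  classical
  have hL0 : 0 < g.L := zero_lt_one.trans_le hL
  have hlen : ∀ z : g.Site, 0 < g.len z := fun z => mul_pos (pow_pos hL0 _) hη
  have hc0 : 0 ≤ cσ := c_nonneg_of_ineq261With h261σ y
  have hRHS : 0 ≤ (BD * (BC * g.L ^ (d + 4)) * cσ * g.L ^ 4 * Real.exp (-(c₃ * g.M))) *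
      Real.exp (-(δ₁ * g.dist y y')) := by positivity
  have hly : 0 < g.len y := hlen y
  have hly' : 0 < g.len y' := hlen y'
  set w : g.Site → ℝ := fun z => g.len z ^ d with hw
  set Y : g.Site → g.Site → ℝ := fun y y'' => Xw i y y'' - X y y'' with hY
  by_cases hy' : hf i y' = 0
  · have : line3Ker w (pf i) (hf i) Y (Ck i) y y' = 0 := by unfold line3Ker; rw [hy', mul_zero]
    rw [this, mul_zero, abs_zero]; exact hRHS
  by_cases hy : pf i y = 0
  · have : line3Ker w (pf i) (hf i) Y (Ck i) y y' = 0 := by unfold line3Ker; rw [hy, zero_mul, zero_mul]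
    rw [this, mul_zero, abs_zero]; exact hRHS
  have hpy' : pf i y' ≠ 0 := pf_ne_zero_of_hf_ne_zero hph hy'
  have hsc : g.scale y ≤ g.scale y' + 1 := scale_le_of_cube hcube hy hpy'
  set S' : Finset g.Site := Finset.univ.filter fun y'' => pf i y'' ≠ 0 with hS'
  set AC : ℝ := BC * g.L ^ (d + 4) * (g.len y' ^ d)⁻¹ / g.len y' ^ 4 with hAC
  have hAC0 : 0 ≤ AC := by rw [hAC]; positivity
  have hCb : ∀ y'' ∈ S', |Ck i y'' y'| ≤ AC * Real.exp (-(δ₁ * g.dist y'' y')) := by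
    intro y'' hy''
    exact ck_weighted_le d hL hη hBC hcube h281 (Finset.mem_filter.mp hy'').2 hpy'
  have hC0 : ∀ y'', y'' ∉ S' → Ck i y'' y' = 0 := by
    intro y'' hy''
    have : ¬ pf i y'' ≠ 0 := fun h => hy'' (Finset.mem_filter.mpr ⟨Finset.mem_univ _, h⟩)
    exact hCk0 i y'' y' (not_not.mp this)
  -- the y″-sum with the row factor □(y) folded in, restricted to □, bounded termwise
  set K : ℝ := BD * Real.exp (-(c₃ * g.M)) * g.len y ^ 4 with hK
  have hK0 : 0 ≤ K := by positivity
  have hsum_eq : pf i y * (∑ y'', w y'' * Y y y'' * hf i y'' * Ck i y'' y') =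
      ∑ y'' ∈ S', (pf i y * (g.len y'' ^ d * Y y y'') * hf i y'') * Ck i y'' y' := by
    rw [Finset.mul_sum]
    rw [← Finset.sum_subset (Finset.subset_univ S') fun y'' _ hy'' => by simp only [hC0 y'' hy'', mul_zero]]
    exact Finset.sum_congr rfl fun y'' _ => by rw [hw]; ring
  have hsum : |pf i y * (∑ y'', w y'' * Y y y'' * hf i y'' * Ck i y'' y')| ≤
      K * AC * ∑ y'' ∈ S', Real.exp (-(1 / 2 * δ₀ * g.dist y y'')) * Real.exp (-(δ₁ * g.dist y'' y')) := by
    rw [hsum_eq, Finset.mul_sum]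
    refine (Finset.abs_sum_le_sum_abs _ _).trans (Finset.sum_le_sum fun y'' hy'' => ?_)
    rw [abs_mul]
    have hA := hdom i y y''
    have hB := hCb y'' hy''
    calc |pf i y * (g.len y'' ^ d * Y y y'') * hf i y''| * |Ck i y'' y'|
        ≤ (K * Real.exp (-(1 / 2 * δ₀ * g.dist y y''))) * (AC * Real.exp (-(δ₁ * g.dist y'' y'))) :=
          mul_le_mul (by rw [hK, hY]; exact hA) hB (abs_nonneg _) (by positivity)
      _ = K * AC * (Real.exp (-(1 / 2 * δ₀ * g.dist y y'')) * Real.exp (-(δ₁ * g.dist y'' y'))) := by ring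
  -- (2.61)-convolution `B6Ineq283.line2_le_line3` with D = 0, then the cube ratio ≤ L⁴
  have h23 := line2_le_line3 htri hd hδ₀.le hδ₁ hsplit h261σ (S' := S') (ρ := fun y'' => g.dist y'' y')
    (y := y) (y' := y') (D := 0) (fun y'' _ => le_rfl) (fun y'' _ => hd y y'')
  have hratio : ratio4 g y y' ≤ g.L ^ 4 := by
    rw [ratio4_eq_len hL0.ne' hη.ne', div_le_iff₀ (pow_pos (hlen y') 4)]
    exact len_pow_four_le hL hη.le hsc
  have hr0 : 0 ≤ ratio4 g y y' := ratio4_nonneg y y'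
  have hsumS : ∑ y'' ∈ S', Real.exp (-(1 / 2 * δ₀ * g.dist y y'')) * Real.exp (-(δ₁ * g.dist y'' y')) ≤
      cσ * g.L ^ 4 * Real.exp (-(δ₁ * g.dist y y')) * (ratio4 g y y')⁻¹ := by
    by_cases hr : ratio4 g y y' = 0
    · -- degenerate only if L = 0, excluded; keep the proof total anyway
      exact absurd hr (by rw [ratio4_eq_len hL0.ne' hη.ne']; positivity)
    have hrpos : 0 < ratio4 g y y' := lt_of_le_of_ne hr0 (Ne.symm hr)
    rw [le_mul_inv_iff₀ hrpos]
    calc (∑ y'' ∈ S', Real.exp (-(1 / 2 * δ₀ * g.dist y y'')) * Real.exp (-(δ₁ * g.dist y'' y'))) *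
          ratio4 g y y' = line283_2 g δ₀ δ₁ S' (fun y'' => g.dist y'' y') y y' := by
          unfold line283_2; ring
      _ ≤ cσ * line283_3 g δ₀ δ₁ 0 y y' := h23
      _ = cσ * (ratio4 g y y' * Real.exp (-(δ₁ * g.dist y y'))) := by
          unfold line283_3; rw [mul_zero, neg_zero, Real.exp_zero, mul_one]
      _ ≤ cσ * (g.L ^ 4 * Real.exp (-(δ₁ * g.dist y y'))) :=
          mul_le_mul_of_nonneg_left (mul_le_mul_of_nonneg_right hratio (Real.exp_pos _).le) hc0
      _ = cσ * g.L ^ 4 * Real.exp (-(δ₁ * g.dist y y')) := by ring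
  have hwP : g.len y' ^ d * (g.len y' ^ d)⁻¹ = 1 := mul_inv_cancel₀ (pow_pos (hlen y') d).ne'
  have hfin : g.len y' ^ d * (K * AC * (cσ * g.L ^ 4 * Real.exp (-(δ₁ * g.dist y y')) * (ratio4 g y y')⁻¹)) ≤
      (BD * (BC * g.L ^ (d + 4)) * cσ * g.L ^ 4 * Real.exp (-(c₃ * g.M))) * Real.exp (-(δ₁ * g.dist y y')) := by
    -- K·AC·(ratio4)⁻¹ carries len y⁴ · (len y′⁴)⁻¹ · (ratio4)⁻¹ = 1
    have hr : ratio4 g y y' = g.len y ^ 4 / g.len y' ^ 4 := ratio4_eq_len hL0.ne' hη.ne' y y'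
    have hl : g.len y ≠ 0 := hly.ne'
    have hl' : g.len y' ≠ 0 := hly'.ne'
    rw [hK, hAC, hr]
    apply le_of_eq
    field_simp
  rw [abs_mul, abs_of_pos (pow_pos (hlen y') d)]
  calc g.len y' ^ d * |line3Ker w (pf i) (hf i) Y (Ck i) y y'|
      = g.len y' ^ d * (|pf i y * (∑ y'', w y'' * Y y y'' * hf i y'' * Ck i y'' y')| * |hf i y'|) := by
        unfold line3Ker; rw [abs_mul]
    _ ≤ g.len y' ^ d * (K * AC * (∑ y'' ∈ S', Real.exp (-(1 / 2 * δ₀ * g.dist y y'')) *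
          Real.exp (-(δ₁ * g.dist y'' y'))) * 1) :=
        mul_le_mul_of_nonneg_left (mul_le_mul hsum (hh1 i y') (abs_nonneg _) (by positivity))
          (pow_nonneg (hlen y').le d)
    _ ≤ g.len y' ^ d * (K * AC * (cσ * g.L ^ 4 * Real.exp (-(δ₁ * g.dist y y')) * (ratio4 g y y')⁻¹)) := by
        rw [mul_one]
        exact mul_le_mul_of_nonneg_left (mul_le_mul_of_nonneg_left hsumS (mul_nonneg hK0 hAC0))
          (pow_nonneg (hlen y').le d)
    _ ≤ _ := hfin

/-- **LINE 4 (THE FAMILY □ ≠ □′, (2.83)), weighted entry.**  For all cubes □, □′ and all y, y′: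
|(L^{j′}η)^d · ((□′ − 1)h_□²Xh_{□′}C_{□′}h_{□′})(y, y′)| ≤ (B_X (B_C L^{d+4}) c_σ L⁴ e^{−⅛δ₀·m_g M})·e^{−δ₁d(y,y′)} — by
`B6Line4Member12.line4Ker_abs_le_285` with C_{□′} masked to supp h_{□′}, D = d(y, supp h_{□′}) realised by a nearest
support point y₀ (same level as y′: single-level supports), the gap m_g·M ≤ D for y ∉ □′ («y ∉ □̃′»); rows y ∈ □′
vanish by the factor (□′ − 1), columns off supp h_{□′} by the factor h_{□′}(y′).
[cite: Balaban1984PropagatorsII, (2.83) p.237] -/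
theorem offPiece_abs_le (htri : Triangle254 g) (hd : ∀ a b : g.Site, 0 ≤ g.dist a b)
    (hsep : B6Ineq268.LevelSep g) (hL : 1 ≤ g.L) (hη : 0 < g.eta) {δ₀ δ₁ σ cσ mg BX BC : ℝ} (hδ₀ : 0 < δ₀)
    (hδ₁ : 0 ≤ δ₁) (hsplit : δ₁ + σ * δ₀ ≤ δ₀ / 4) (h261σ : Ineq261With cσ g δ₀ σ) (hRM : 0 ≤ g.R * g.M)
    (hthr : g.L ^ 4 ≤ Real.exp (1 / 8 * δ₀ * g.R * g.M)) (hBX : 0 ≤ BX) (hBC : 0 ≤ BC) (d : ℕ)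
    {pf hf : D → g.Site → ℝ} {js : D → ℕ} {X : g.Site → g.Site → ℝ} {Ck : D → g.Site → g.Site → ℝ}
    (hpf01 : ∀ i y, pf i y = 0 ∨ pf i y = 1) (hph : ∀ i y, pf i y * hf i y = hf i y)
    (hh1 : ∀ i y, |hf i y| ≤ 1) (hcube : ∀ i y, pf i y ≠ 0 → js i ≤ g.scale y ∧ g.scale y ≤ js i + 1)
    (hlev : ∀ i y y', hf i y ≠ 0 → hf i y' ≠ 0 → g.scale y = g.scale y')
    (hgap : ∀ i y y'', pf i y = 0 → hf i y'' ≠ 0 → mg * g.M ≤ g.dist y y'')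
    (hX : ∀ y y'', |g.len y'' ^ d * X y y''| ≤ BX * g.len y ^ 4 * Real.exp (-(1 / 2 * δ₀ * g.dist y y'')))
    (h281 : ∀ i y y', pf i y ≠ 0 → pf i y' ≠ 0 →
      |Ck i y y'| ≤ BC / (g.L ^ js i * g.eta) ^ (d + 4) * Real.exp (-(δ₁ * g.dist y y')))
    (i i' : D) (y y' : g.Site) :
    |g.len y' ^ d * line4Ker (fun z => g.len z ^ d) (pf i') (hf i) (hf i') X (Ck i') y y'| ≤
      (BX * (BC * g.L ^ (d + 4)) * cσ * g.L ^ 4 * Real.exp (-(1 / 8 * δ₀ * (mg * g.M)))) *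
        Real.exp (-(δ₁ * g.dist y y')) := by
  classical
  have hL0 : 0 < g.L := zero_lt_one.trans_le hL
  have hlen : ∀ z : g.Site, 0 < g.len z := fun z => mul_pos (pow_pos hL0 _) hη
  have hc0 : 0 ≤ cσ := c_nonneg_of_ineq261With h261σ y
  have hRHS : 0 ≤ (BX * (BC * g.L ^ (d + 4)) * cσ * g.L ^ 4 * Real.exp (-(1 / 8 * δ₀ * (mg * g.M)))) *
      Real.exp (-(δ₁ * g.dist y y')) := by positivity
  set w : g.Site → ℝ := fun z => g.len z ^ d with hw
  by_cases hy' : hf i' y' = 0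
  · have : line4Ker w (pf i') (hf i) (hf i') X (Ck i') y y' = 0 := by unfold line4Ker; rw [hy', mul_zero]
    rw [this, mul_zero, abs_zero]; exact hRHS
  by_cases hy : pf i' y = 0
  swap
  · -- y ∈ □′: the factor (□′(y) − 1) vanishes
    have h1 : pf i' y = 1 := (hpf01 i' y).resolve_left hy
    have : line4Ker w (pf i') (hf i) (hf i') X (Ck i') y y' = 0 := by
      unfold line4Ker; rw [h1, sub_self, zero_mul, zero_mul, zero_mul]
    rw [this, mul_zero, abs_zero]; exact hRHS
  -- y ∉ □′, y′ ∈ supp h_{□′}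
  have hpy' : pf i' y' ≠ 0 := pf_ne_zero_of_hf_ne_zero hph hy'
  set C' : g.Site → g.Site → ℝ := fun y'' z => if hf i' y'' = 0 then 0 else Ck i' y'' z with hC'
  set S' : Finset g.Site := Finset.univ.filter fun y'' => hf i' y'' ≠ 0 with hS'
  have hne : S'.Nonempty := ⟨y', Finset.mem_filter.mpr ⟨Finset.mem_univ _, hy'⟩⟩
  obtain ⟨y₀, hy₀S, hy₀min⟩ := Finset.exists_min_image S' (fun y'' => g.dist y y'') hne
  have hy₀ : hf i' y₀ ≠ 0 := (Finset.mem_filter.mp hy₀S).2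
  set Dm : ℝ := g.dist y y₀ with hDm
  have hCb : ∀ y'' ∈ S', |C' y'' y'| ≤ BC * g.L ^ (d + 4) * (g.len y' ^ d)⁻¹ / g.len y' ^ 4 *
      Real.exp (-(δ₁ * g.dist y'' y')) := by
    intro y'' hy''
    have h'' : hf i' y'' ≠ 0 := (Finset.mem_filter.mp hy'').2
    rw [hC']; simp only [if_neg h'']
    exact ck_weighted_le d hL hη hBC hcube h281 (pf_ne_zero_of_hf_ne_zero hph h'') hpy'
  have hC0 : ∀ y'', y'' ∉ S' → C' y'' y' = 0 := by
    intro y'' hy''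
    have : ¬ hf i' y'' ≠ 0 := fun h => hy'' (Finset.mem_filter.mpr ⟨Finset.mem_univ _, h⟩)
    rw [hC']; simp only [not_not.mp this, if_true]
  have hmain := line4Ker_abs_le_285 htri hd hsep hL hη hδ₀.le hδ₁ hsplit h261σ hRM hthr hBX
    (by positivity : 0 ≤ BC * g.L ^ (d + 4)) (P := fun z => (g.len z ^ d)⁻¹)
    (fun z => inv_nonneg.mpr (pow_nonneg (hlen z).le d)) (w := w) (p' := pf i') (h := hf i) (h' := hf i')
    (X := X) (C := C') (S' := S') (ρ := fun y'' => g.dist y'' y') (y := y) (y' := y') (y₀ := y₀) (D := Dm)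
    (Mg := mg * g.M) (hX y) hCb hC0 (fun y'' _ => le_rfl) (fun y'' hy'' => hy₀min y'' hy'')
    (hlev i' y₀ y' hy₀ hy') le_rfl (hgap i' y y₀ hy hy₀) (abs_pf_sub_one_le_one hpf01 i' y) (hh1 i y)
    (hh1 i')
  have hwP : g.len y' ^ d * (g.len y' ^ d)⁻¹ = 1 := mul_inv_cancel₀ (pow_pos (hlen y') d).ne'
  rw [line4Ker_mask, abs_mul, abs_of_pos (pow_pos (hlen y') d)]
  calc g.len y' ^ d * |line4Ker w (pf i') (hf i) (hf i') X C' y y'|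
      ≤ g.len y' ^ d * ((BX * (BC * g.L ^ (d + 4)) * cσ * g.L ^ 4 * Real.exp (-(1 / 8 * δ₀ * (mg * g.M)))) *
          Real.exp (-(δ₁ * g.dist y y')) * (g.len y' ^ d)⁻¹) :=
        mul_le_mul_of_nonneg_left hmain (pow_nonneg (hlen y').le d)
    _ = (BX * (BC * g.L ^ (d + 4)) * cσ * g.L ^ 4 * Real.exp (-(1 / 8 * δ₀ * (mg * g.M)))) *
          Real.exp (-(δ₁ * g.dist y y')) * (g.len y' ^ d * (g.len y' ^ d)⁻¹) := by ring
    _ = _ := by rw [hwP, mul_one]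

end Pieces

/-! ## §4. The assembly: (2.82) + (2.85) + Lemma 2.1 ⟹ Proposition 2.3 (2.87), no per-term hypothesis left -/

section Assembly

variable {g : B6.Geometry} [DecidableEq g.Site] {D : Type} [Fintype D] [DecidableEq D]

omit [DecidableEq g.Site] [Fintype D] in
/-- The diagonal operator R_{□,□} of `B6Expansion282.Rpair`. [cite: Balaban1984PropagatorsII, (2.82) p.237] -/
theorem Rpair_self {A : Type} [Ring A] (x : A) (p t h : D → A) (i : D) :
    Rpair x p t h i i = comm (h i) (locOp p t i) + p i * (t i - x) * h i := by
  simp [Rpair]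

omit [DecidableEq g.Site] [Fintype D] in
/-- The off-diagonal operator R_{□,□′}, □ ≠ □′, of `B6Expansion282.Rpair`. [cite: Balaban1984PropagatorsII, (2.82)–(2.83) p.237] -/
theorem Rpair_ne {A : Type} [Ring A] (x : A) (p t h : D → A) {i i' : D} (hii : i ≠ i') :
    Rpair x p t h i i' = (p i' - 1) * (h i * h i) * x * h i' := by
  simp [Rpair, hii]

/-- κ₂: the size of the commutator family (M·ε, `commPiece_abs_le`). [cite: Balaban1984PropagatorsII, (2.85) p.238] -/
noncomputable def kappa2 (g : B6.Geometry) (d : ℕ) (s δ₀ cσ BX BC : ℝ) : ℝ :=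
  s * BX * (BC * g.L ^ (d + 4)) * g.L ^ 4 * cσ / (Real.exp 1 * (1 / 4 * δ₀))

/-- κ₃: the size of the change-of-domain family in front of e^{−c₃M} (`domPiece_abs_le`). [cite: Balaban1984PropagatorsII, (2.85) p.238] -/
noncomputable def kappa3 (g : B6.Geometry) (d : ℕ) (cσ BD BC : ℝ) : ℝ :=
  BD * (BC * g.L ^ (d + 4)) * cσ * g.L ^ 4

/-- κ₄: the size of the off-diagonal family in front of e^{−⅛δ₀m_gM} (`offPiece_abs_le`). [cite: Balaban1984PropagatorsII, (2.83)/(2.85) pp.237–238] -/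
noncomputable def kappa4 (g : B6.Geometry) (d : ℕ) (cσ BX BC : ℝ) : ℝ :=
  BX * (BC * g.L ^ (d + 4)) * cσ * g.L ^ 4

/-- θ of (2.85): θ = n₀(κ₂/M + κ₃e^{−c₃M}) + n₀²κ₄e^{−(⅛δ₀m_g)M} — the printed *"O(M⁻¹)"* with every constant explicit.
[cite: Balaban1984PropagatorsII, (2.85) p.238] -/
noncomputable def theta285 (g : B6.Geometry) (d n₀ : ℕ) (s δ₀ cσ c₃ mg BX BD BC : ℝ) : ℝ :=
  n₀ * (kappa2 g d s δ₀ cσ BX BC / g.M + kappa3 g d cσ BD BC * Real.exp (-(c₃ * g.M))) +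
    n₀ ^ 2 * (kappa4 g d cσ BX BC * Real.exp (-((1 / 8 * δ₀ * mg) * g.M)))

/-- K with θ ≤ K/M (`B6Prop23Chain.theta_le_inv_M`): K = n₀(κ₂ + κ₃/(e c₃)) + n₀²κ₄/(e·⅛δ₀m_g).
[cite: Balaban1984PropagatorsII, (2.85) p.238] -/
noncomputable def K285 (g : B6.Geometry) (d n₀ : ℕ) (s δ₀ cσ c₃ mg BX BD BC : ℝ) : ℝ :=
  n₀ * (kappa2 g d s δ₀ cσ BX BC + kappa3 g d cσ BD BC / (Real.exp 1 * c₃)) +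
    n₀ ^ 2 * (kappa4 g d cσ BX BC / (Real.exp 1 * (1 / 8 * δ₀ * mg)))

omit [Fintype D] in
/-- **THE DIAGONAL TERMS R_{□,□}C_□h_□ (lines 2 + 3 of (2.82)) — the hypothesis `hdiag` of
`B6Prop23Chain.mat_R282_abs_le` DISCHARGED**: |mat(R_{□,□}C_□h_□) y y′| ≤ (κ₂/M + κ₃e^{−c₃M})·e^{−δ₁d(y,y′)}.
[cite: Balaban1984PropagatorsII, (2.82)/(2.85) pp.237–238] -/
theorem mat_diag_abs_le (htri : Triangle254 g) (hd : ∀ a b : g.Site, 0 ≤ g.dist a b) (hL : 1 ≤ g.L)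
    (hη : 0 < g.eta) {δ₀ δ₁ σ cσ c₃ s BX BD BC : ℝ} (hδ₀ : 0 < δ₀) (hδ₁ : 0 ≤ δ₁)
    (hsplit : δ₁ + σ * δ₀ ≤ δ₀ / 4) (h261σ : Ineq261With cσ g δ₀ σ) (hs : 0 ≤ s) (hM : 0 < g.M)
    (hBX : 0 ≤ BX) (hBD : 0 ≤ BD) (hBC : 0 ≤ BC) (d : ℕ)
    {pf hf : D → g.Site → ℝ} {js : D → ℕ} {X : g.Site → g.Site → ℝ} {Xw Ck : D → g.Site → g.Site → ℝ}
    (hpf01 : ∀ i y, pf i y = 0 ∨ pf i y = 1) (hph : ∀ i y, pf i y * hf i y = hf i y)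
    (hh1 : ∀ i y, |hf i y| ≤ 1) (hLip : ∀ i y y'', |hf i y - hf i y''| ≤ s / g.M * g.dist y y'')
    (hcube : ∀ i y, pf i y ≠ 0 → js i ≤ g.scale y ∧ g.scale y ≤ js i + 1)
    (hXw : ∀ i y y'', |g.len y'' ^ d * Xw i y y''| ≤ BX * g.len y ^ 4 * Real.exp (-(1 / 2 * δ₀ * g.dist y y'')))
    (hdom : ∀ i y y'', |pf i y * (g.len y'' ^ d * (Xw i y y'' - X y y'')) * hf i y''| ≤
      BD * Real.exp (-(c₃ * g.M)) * g.len y ^ 4 * Real.exp (-(1 / 2 * δ₀ * g.dist y y'')))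
    (h281 : ∀ i y y', pf i y ≠ 0 → pf i y' ≠ 0 →
      |Ck i y y'| ≤ BC / (g.L ^ js i * g.eta) ^ (d + 4) * Real.exp (-(δ₁ * g.dist y y')))
    (hCk0 : ∀ i y'' y', pf i y'' = 0 → Ck i y'' y' = 0) (i : D) (y y' : g.Site) :
    |mat (Rpair (kerOp (fun z => g.len z ^ d) X) (fun i => mulOp (pf i))
        (fun i => kerOp (fun z => g.len z ^ d) (Xw i)) (fun i => mulOp (hf i)) i i *
        kerOp (fun z => g.len z ^ d) (Ck i) * mulOp (hf i)) y y'| ≤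
      (kappa2 g d s δ₀ cσ BX BC / g.M + kappa3 g d cσ BD BC * Real.exp (-(c₃ * g.M))) *
        Real.exp (-(δ₁ * g.dist y y')) := by
  set w : g.Site → ℝ := fun z => g.len z ^ d with hw
  have hop : Rpair (kerOp w X) (fun i => mulOp (pf i)) (fun i => kerOp w (Xw i)) (fun i => mulOp (hf i)) i i *
        kerOp w (Ck i) * mulOp (hf i) =
      kerOp w (line2Ker w (hf i) (fun y y'' => pf i y * Xw i y y'' * pf i y'') (Ck i)) +
        kerOp w (line3Ker w (pf i) (hf i) (fun y y'' => Xw i y y'' - X y y'') (Ck i)) := by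
    rw [Rpair_self, add_mul, add_mul, locOp_kerOp, line2_operator_eq, kerOp_sub_kerOp, line3_operator_eq]
  rw [hop, mat_add, mat_kerOp, mat_kerOp]
  have h2 := commPiece_abs_le htri hd hL hη hδ₀ hδ₁ hsplit h261σ hs hM hBX hBC d hpf01 hph hh1 hLip hcube hXw
    h281 hCk0 i y y'
  have h3 := domPiece_abs_le htri hd hL hη hδ₀ hδ₁ hsplit h261σ hBD hBC d (X := X) hph hh1 hcube hdom h281 hCk0
    i y y'
  refine (abs_add_le _ _).trans ((add_le_add h2 h3).trans (le_of_eq ?_))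
  simp only [kappa2, kappa3]
  ring

omit [Fintype D] in
/-- **THE OFF-DIAGONAL TERMS R_{□,□′}C_{□′}h_{□′}, □ ≠ □′ (line 4 of (2.82), the example (2.83)) — the hypothesis
`hoff` of `B6Prop23Chain.mat_R282_abs_le` DISCHARGED**: |mat(R_{□,□′}C_{□′}h_{□′}) y y′| ≤ κ₄e^{−(⅛δ₀m_g)M}·e^{−δ₁d(y,y′)}.
[cite: Balaban1984PropagatorsII, (2.83)/(2.85) pp.237–238] -/
theorem mat_off_abs_le (htri : Triangle254 g) (hd : ∀ a b : g.Site, 0 ≤ g.dist a b)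
    (hsep : B6Ineq268.LevelSep g) (hL : 1 ≤ g.L) (hη : 0 < g.eta) {δ₀ δ₁ σ cσ mg BX BC : ℝ} (hδ₀ : 0 < δ₀)
    (hδ₁ : 0 ≤ δ₁) (hsplit : δ₁ + σ * δ₀ ≤ δ₀ / 4) (h261σ : Ineq261With cσ g δ₀ σ) (hRM : 0 ≤ g.R * g.M)
    (hthr : g.L ^ 4 ≤ Real.exp (1 / 8 * δ₀ * g.R * g.M)) (hBX : 0 ≤ BX) (hBC : 0 ≤ BC) (d : ℕ)
    {pf hf : D → g.Site → ℝ} {js : D → ℕ} {X : g.Site → g.Site → ℝ} {Xw Ck : D → g.Site → g.Site → ℝ}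
    (hpf01 : ∀ i y, pf i y = 0 ∨ pf i y = 1) (hph : ∀ i y, pf i y * hf i y = hf i y)
    (hh1 : ∀ i y, |hf i y| ≤ 1) (hcube : ∀ i y, pf i y ≠ 0 → js i ≤ g.scale y ∧ g.scale y ≤ js i + 1)
    (hlev : ∀ i y y', hf i y ≠ 0 → hf i y' ≠ 0 → g.scale y = g.scale y')
    (hgap : ∀ i y y'', pf i y = 0 → hf i y'' ≠ 0 → mg * g.M ≤ g.dist y y'')
    (hX : ∀ y y'', |g.len y'' ^ d * X y y''| ≤ BX * g.len y ^ 4 * Real.exp (-(1 / 2 * δ₀ * g.dist y y'')))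
    (h281 : ∀ i y y', pf i y ≠ 0 → pf i y' ≠ 0 →
      |Ck i y y'| ≤ BC / (g.L ^ js i * g.eta) ^ (d + 4) * Real.exp (-(δ₁ * g.dist y y')))
    {i i' : D} (hii : i ≠ i') (y y' : g.Site) :
    |mat (Rpair (kerOp (fun z => g.len z ^ d) X) (fun i => mulOp (pf i))
        (fun i => kerOp (fun z => g.len z ^ d) (Xw i)) (fun i => mulOp (hf i)) i i' *
        kerOp (fun z => g.len z ^ d) (Ck i') * mulOp (hf i')) y y'| ≤
      kappa4 g d cσ BX BC * Real.exp (-((1 / 8 * δ₀ * mg) * g.M)) * Real.exp (-(δ₁ * g.dist y y')) := by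
  set w : g.Site → ℝ := fun z => g.len z ^ d with hw
  have hop : Rpair (kerOp w X) (fun i => mulOp (pf i)) (fun i => kerOp w (Xw i)) (fun i => mulOp (hf i)) i i' *
        kerOp w (Ck i') * mulOp (hf i') = kerOp w (line4Ker w (pf i') (hf i) (hf i') X (Ck i')) := by
    rw [Rpair_ne _ _ _ _ hii, line4_operator_eq]
  rw [hop, mat_kerOp]
  have h4 := offPiece_abs_le htri hd hsep hL hη hδ₀ hδ₁ hsplit h261σ hRM hthr hBX hBC d hpf01 hph hh1 hcube hlev
    hgap hX h281 i i' y y'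
  refine h4.trans (le_of_eq ?_)
  simp only [kappa4]
  ring_nf

/-- **(2.85) WITH NO PER-TERM HYPOTHESIS LEFT**: |mat R y y′| ≤ θ·e^{−δ₁d(y,y′)}, θ = `theta285` (from `mat_diag_abs_le`,
`mat_off_abs_le` and the counting assembly `B6Prop23Chain.mat_R282_abs_le` with the overlap number n₀).
[cite: Balaban1984PropagatorsII, (2.85) p.238] -/
theorem mat_R_abs_le (htri : Triangle254 g) (hd : ∀ a b : g.Site, 0 ≤ g.dist a b)
    (hsep : B6Ineq268.LevelSep g) (hL : 1 ≤ g.L) (hη : 0 < g.eta) (hM : 0 < g.M) (hRM : 0 ≤ g.R * g.M)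
    {δ₀ δ₁ σ cσ c₃ s mg BX BD BC : ℝ} (hδ₀ : 0 < δ₀) (hδ₁ : 0 ≤ δ₁) (hsplit : δ₁ + σ * δ₀ ≤ δ₀ / 4)
    (h261σ : Ineq261With cσ g δ₀ σ) (hthr : g.L ^ 4 ≤ Real.exp (1 / 8 * δ₀ * g.R * g.M)) (hs : 0 ≤ s)
    (hBX : 0 ≤ BX) (hBD : 0 ≤ BD) (hBC : 0 ≤ BC) (d : ℕ)
    {pf hf : D → g.Site → ℝ} {js : D → ℕ} {n₀ : ℕ} {X : g.Site → g.Site → ℝ}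
    {Xw Ck : D → g.Site → g.Site → ℝ}
    (hover : ∀ y, (Finset.univ.filter fun i => hf i y ≠ 0).card ≤ n₀)
    (hpf01 : ∀ i y, pf i y = 0 ∨ pf i y = 1) (hph : ∀ i y, pf i y * hf i y = hf i y)
    (hh1 : ∀ i y, |hf i y| ≤ 1) (hLip : ∀ i y y'', |hf i y - hf i y''| ≤ s / g.M * g.dist y y'')
    (hcube : ∀ i y, pf i y ≠ 0 → js i ≤ g.scale y ∧ g.scale y ≤ js i + 1)
    (hlev : ∀ i y y', hf i y ≠ 0 → hf i y' ≠ 0 → g.scale y = g.scale y')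
    (hgap : ∀ i y y'', pf i y = 0 → hf i y'' ≠ 0 → mg * g.M ≤ g.dist y y'')
    (hX : ∀ y y'', |g.len y'' ^ d * X y y''| ≤ BX * g.len y ^ 4 * Real.exp (-(1 / 2 * δ₀ * g.dist y y'')))
    (hXw : ∀ i y y'', |g.len y'' ^ d * Xw i y y''| ≤ BX * g.len y ^ 4 * Real.exp (-(1 / 2 * δ₀ * g.dist y y'')))
    (hdom : ∀ i y y'', |pf i y * (g.len y'' ^ d * (Xw i y y'' - X y y'')) * hf i y''| ≤
      BD * Real.exp (-(c₃ * g.M)) * g.len y ^ 4 * Real.exp (-(1 / 2 * δ₀ * g.dist y y'')))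
    (h281 : ∀ i y y', pf i y ≠ 0 → pf i y' ≠ 0 →
      |Ck i y y'| ≤ BC / (g.L ^ js i * g.eta) ^ (d + 4) * Real.exp (-(δ₁ * g.dist y y')))
    (hCk0 : ∀ i y'' y', pf i y'' = 0 → Ck i y'' y' = 0) (y y' : g.Site) :
    |mat (R282 (kerOp (fun z => g.len z ^ d) X) (fun i => mulOp (pf i))
        (fun i => kerOp (fun z => g.len z ^ d) (Xw i)) (fun i => mulOp (hf i))
        (fun i => kerOp (fun z => g.len z ^ d) (Ck i))) y y'| ≤
      theta285 g d n₀ s δ₀ cσ c₃ mg BX BD BC * Real.exp (-(δ₁ * g.dist y y')) := by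
  have hc0 : 0 ≤ cσ := c_nonneg_of_ineq261With h261σ y
  have hL0 : 0 < g.L := zero_lt_one.trans_le hL
  have hεd : 0 ≤ kappa2 g d s δ₀ cσ BX BC / g.M + kappa3 g d cσ BD BC * Real.exp (-(c₃ * g.M)) := by
    unfold kappa2 kappa3; positivity
  have hεo : 0 ≤ kappa4 g d cσ BX BC * Real.exp (-((1 / 8 * δ₀ * mg) * g.M)) := by
    unfold kappa4; positivity
  have h := mat_R282_abs_le (kerOp (fun z => g.len z ^ d) X) (fun i => kerOp (fun z => g.len z ^ d) (Xw i))
    (fun i => kerOp (fun z => g.len z ^ d) (Ck i)) pf hf hover (E := fun y y' => Real.exp (-(δ₁ * g.dist y y')))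
    (fun _ _ => (Real.exp_pos _).le) hεd hεo
    (fun i y y' => mat_diag_abs_le htri hd hL hη hδ₀ hδ₁ hsplit h261σ hs hM hBX hBD hBC d hpf01 hph hh1 hLip
      hcube hXw hdom h281 hCk0 i y y')
    (fun i i' hii y y' => mat_off_abs_le htri hd hsep hL hη hδ₀ hδ₁ hsplit h261σ hRM hthr hBX hBC d hpf01 hph
      hh1 hcube hlev hgap hX h281 hii y y') y y'
  refine h.trans (le_of_eq ?_)
  simp only [theta285]

omit [DecidableEq g.Site] [Fintype D] [DecidableEq D] in
/-- **θ = O(M⁻¹)**: θ ≤ K/M with K = `K285` (M-independent when n₀, s, m_g, the B's and c_σ are).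
[cite: Balaban1984PropagatorsII, (2.85) «O(M⁻¹)» p.238] -/
theorem theta285_le (hM : 0 < g.M) {d n₀ : ℕ} {s δ₀ cσ c₃ mg BX BD BC : ℝ} (hδ₀ : 0 < δ₀) (hc₃ : 0 < c₃)
    (hmg : 0 < mg) (hcσ : 0 ≤ cσ) (hBX : 0 ≤ BX) (hBD : 0 ≤ BD) (hBC : 0 ≤ BC) (hL : 0 ≤ g.L) :
    theta285 g d n₀ s δ₀ cσ c₃ mg BX BD BC ≤ K285 g d n₀ s δ₀ cσ c₃ mg BX BD BC / g.M := by
  unfold theta285 K285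
  exact theta_le_inv_M hM hc₃ (by positivity : 0 < 1 / 8 * δ₀ * mg) (by unfold kappa3; positivity)
    (by unfold kappa4; positivity) (Nat.cast_nonneg n₀)

/-- **PROPOSITION 2.3 ASSEMBLED.**  On the carrier 𝔅 = `g.Site` with the pairing (2.69) (weights (L^{j′}η)^d), let
X = Q′G′²Q′* = K_w(X), X̃_□ = Q′G′(□̃)²Q′* = K_w(X̃_□), C_□ = K_w(C_□), h_□, □ the multiplication operators, and
C = Σ_□ h_□C_□h_□, R = Σ_{□,□′}R_{□,□′}C_{□′}h_{□′} the operators of (2.70)/(2.82) (`B6Expansion282.Cglued`∕`R282`).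
ASSUME the located cover∕structure facts of pp. 229–235 (□ ∈ {0,1}, □h_□ = h_□, Σ_□h_□² = 1, |h_□(y) − h_□(y″)| ≤
(s/M)d(y,y″), overlap number n₀, cube scales, single-level supports, the gap m_g·M between □ᶜ and supp h_□, C_□(y″, ·) = 0
off □), the kernel majorants of X and X̃_□ at the rate ½δ₀, the change-of-domain majorant with its factor e^{−c₃M},
(2.81) on □ × □, (2.70) as (□X̃_□□)C_□h_□ = h_□, the geometry (2.54), (2.60), (2.61)∕(2.63) (generic constants), the
thresholds L⁴ ≤ e^{⅛δ₀RM} and M ≥ 2Kc (*"for M large enough"*).  THEN X has a unique two-sided inverse G = C + GR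
(= C(I − R)⁻¹, (2.86)) and *"|(Q′G′²Q′*)⁻¹(y, y′)| ≤ O(1)(L^jη)^{−4}(L^{j′}η)^{−d}e^{−½δ₁d(y,y′)}"* (2.87) with
O(1) = 2·n₀B_C L^{d+4}·c.  Every O(·) of the printed proof is an explicit function of the free constants; no per-term
estimate is a hypothesis any more. [cite: Balaban1984PropagatorsII, Prop. 2.3, (2.82)–(2.87) pp.237–238] -/
theorem prop23_assembled (d : ℕ) (htri : Triangle254 g) (hrefl : ∀ y : g.Site, g.dist y y = 0)
    (hd : ∀ a b : g.Site, 0 ≤ g.dist a b) (hsep : B6Ineq268.LevelSep g) (hL : 1 ≤ g.L) (hη : 0 < g.eta)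
    (hM : 0 < g.M) (hRM : 0 ≤ g.R * g.M)
    {δ₀ δ₁ σ cσ c c₃ s mg BX BD BC : ℝ} (hδ₀ : 0 < δ₀) (hδ₁ : 0 ≤ δ₁) (hsplit : δ₁ + σ * δ₀ ≤ δ₀ / 4)
    (h261σ : Ineq261With cσ g δ₀ σ) (hthr : g.L ^ 4 ≤ Real.exp (1 / 8 * δ₀ * g.R * g.M))
    (h261 : Ineq261With c g δ₁ (1 / 2)) (h263 : Ineq263With c g δ₁ (1 / 2)) (hc : 0 ≤ c)
    (hc₃ : 0 < c₃) (hs : 0 ≤ s) (hmg : 0 < mg) (hBX : 0 ≤ BX) (hBD : 0 ≤ BD) (hBC : 0 ≤ BC)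
    {pf hf : D → g.Site → ℝ} {js : D → ℕ} {n₀ : ℕ} {X : g.Site → g.Site → ℝ}
    {Xw Ck : D → g.Site → g.Site → ℝ}
    (hover : ∀ y, (Finset.univ.filter fun i => hf i y ≠ 0).card ≤ n₀)
    (hpf01 : ∀ i y, pf i y = 0 ∨ pf i y = 1) (hph : ∀ i y, pf i y * hf i y = hf i y)
    (h236 : ∀ y, ∑ i, hf i y ^ 2 = 1) (hLip : ∀ i y y'', |hf i y - hf i y''| ≤ s / g.M * g.dist y y'')
    (hcube : ∀ i y, pf i y ≠ 0 → js i ≤ g.scale y ∧ g.scale y ≤ js i + 1)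
    (hlev : ∀ i y y', hf i y ≠ 0 → hf i y' ≠ 0 → g.scale y = g.scale y')
    (hgap : ∀ i y y'', pf i y = 0 → hf i y'' ≠ 0 → mg * g.M ≤ g.dist y y'')
    (hX : ∀ y y'', |g.len y'' ^ d * X y y''| ≤ BX * g.len y ^ 4 * Real.exp (-(1 / 2 * δ₀ * g.dist y y'')))
    (hXw : ∀ i y y'', |g.len y'' ^ d * Xw i y y''| ≤ BX * g.len y ^ 4 * Real.exp (-(1 / 2 * δ₀ * g.dist y y'')))
    (hdom : ∀ i y y'', |pf i y * (g.len y'' ^ d * (Xw i y y'' - X y y'')) * hf i y''| ≤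
      BD * Real.exp (-(c₃ * g.M)) * g.len y ^ 4 * Real.exp (-(1 / 2 * δ₀ * g.dist y y'')))
    (h281 : ∀ i y y', pf i y ≠ 0 → pf i y' ≠ 0 →
      |Ck i y y'| ≤ BC / (g.L ^ js i * g.eta) ^ (d + 4) * Real.exp (-(δ₁ * g.dist y y')))
    (hCk0 : ∀ i y'' y', pf i y'' = 0 → Ck i y'' y' = 0)
    (h270 : ∀ i, locOp (fun i => mulOp (pf i)) (fun i => kerOp (fun z => g.len z ^ d) (Xw i)) i *
      kerOp (fun z => g.len z ^ d) (Ck i) * mulOp (hf i) = mulOp (hf i))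
    (hKM : 2 * K285 g d n₀ s δ₀ cσ c₃ mg BX BD BC * c ≤ g.M) :
    ∃ G : Module.End ℝ (g.Site → ℝ),
      G * kerOp (fun z => g.len z ^ d) X = 1 ∧ kerOp (fun z => g.len z ^ d) X * G = 1 ∧
      G = Cglued (fun i => mulOp (hf i)) (fun i => kerOp (fun z => g.len z ^ d) (Ck i)) +
        G * R282 (kerOp (fun z => g.len z ^ d) X) (fun i => mulOp (pf i))
          (fun i => kerOp (fun z => g.len z ^ d) (Xw i)) (fun i => mulOp (hf i))
          (fun i => kerOp (fun z => g.len z ^ d) (Ck i)) ∧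
      (∀ G' : Module.End ℝ (g.Site → ℝ), G' * kerOp (fun z => g.len z ^ d) X = 1 → G' = G) ∧
      ∀ y y', |mat G y y' / g.len y' ^ d| ≤
        2 * (n₀ * (BC * g.L ^ (d + 4))) * c * g.len y ^ (-(4 : ℝ)) * g.len y' ^ (-(d : ℝ)) *
          Real.exp (-(δ₁ / 2 * g.dist y y')) := by
  -- an empty carrier 𝔅 makes every operator on ℝ^𝔅 equal: nothing to prove
  rcases isEmpty_or_nonempty g.Site with he | hne
  · exact ⟨0, Subsingleton.elim _ _, Subsingleton.elim _ _, Subsingleton.elim _ _, fun G' _ => Subsingleton.elim _ _,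
      fun y _ => (he.false y).elim⟩
  obtain ⟨y₀⟩ := hne
  have hcσ : 0 ≤ cσ := c_nonneg_of_ineq261With h261σ y₀
  have hL0 : 0 < g.L := zero_lt_one.trans_le hL
  have hlen : ∀ z : g.Site, 0 < g.len z := fun z => mul_pos (pow_pos hL0 _) hη
  have hh1 : ∀ i y, |hf i y| ≤ 1 := abs_hf_le_one h236
  -- (2.82): X·C = 1 − R
  have hphOp : ∀ i, mulOp (pf i) * mulOp (hf i) = mulOp (hf i) := by
    intro i
    rw [mulOp_mul_mulOp]
    exact congrArg mulOp (funext fun y => hph i y)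
  have hXC := expansion282 (kerOp (fun z => g.len z ^ d) X) (p := fun i => mulOp (pf i))
    (t := fun i => kerOp (fun z => g.len z ^ d) (Xw i)) (h := fun i => mulOp (hf i))
    (c := fun i => kerOp (fun z => g.len z ^ d) (Ck i)) hphOp (partitionSq_mulOp hf h236) h270
  -- (2.85) with θ explicit, θ ≤ K/M, and «M large enough»
  set θ : ℝ := theta285 g d n₀ s δ₀ cσ c₃ mg BX BD BC with hθdef
  have hθ0 : 0 ≤ θ := by
    rw [hθdef]; unfold theta285 kappa2 kappa3 kappa4; positivity
  have hR : ∀ y y', |mat (R282 (kerOp (fun z => g.len z ^ d) X) (fun i => mulOp (pf i))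
      (fun i => kerOp (fun z => g.len z ^ d) (Xw i)) (fun i => mulOp (hf i))
      (fun i => kerOp (fun z => g.len z ^ d) (Ck i))) y y'| ≤ θ * Real.exp (-(δ₁ * g.dist y y')) :=
    fun y y' => mat_R_abs_le htri hd hsep hL hη hM hRM hδ₀ hδ₁ hsplit h261σ hthr hs hBX hBD hBC d hover hpf01 hph
      hh1 hLip hcube hlev hgap hX hXw hdom h281 hCk0 y y'
  have hθK : θ ≤ K285 g d n₀ s δ₀ cσ c₃ mg BX BD BC / g.M :=
    theta285_le hM hδ₀ hc₃ hmg hcσ hBX hBD hBC hL0.le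
  obtain ⟨-, hsmall, hinv2⟩ := smallness_of_M_large hM hc hθK hKM
  -- the C-majorant from the glued (2.81)
  have hscH : ∀ i y, hf i y ≠ 0 → g.scale y ≤ js i + 1 :=
    fun i y h => (hcube i y (pf_ne_zero_of_hf_ne_zero hph h)).2
  have h281H : ∀ i y y', hf i y ≠ 0 → hf i y' ≠ 0 →
      |Ck i y y'| ≤ BC / (g.L ^ js i * g.eta) ^ (d + 4) * Real.exp (-(δ₁ * g.dist y y')) :=
    fun i y y' hy hy' => h281 i y y' (pf_ne_zero_of_hf_ne_zero hph hy) (pf_ne_zero_of_hf_ne_zero hph hy')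
  have hC := mat_Cglued_abs_le d hL hη hf Ck js hover hh1 hscH hBC h281H
  set A : ℝ := n₀ * (BC * g.L ^ (d + 4)) with hAdef
  have hA : 0 ≤ A := by positivity
  obtain ⟨G, hGX, hXG, hfix, huniq, hb⟩ := prop23_kernel_287 d hL0 hη c δ₁ θ A hA hθ0 hc hδ₁ htri hrefl hd
    h261 h263 hsmall hXC (fun y y' => hC y y') hR
  refine ⟨G, hGX, hXG, hfix, huniq, fun y y' => (hb y y').trans ?_⟩
  have hP : 0 ≤ g.len y ^ (-(4 : ℝ)) * g.len y' ^ (-(d : ℝ)) * Real.exp (-(δ₁ / 2 * g.dist y y')) := by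
    have := (hlen y).le; have := (hlen y').le; positivity
  calc A * c * (1 - θ * c)⁻¹ * g.len y ^ (-(4 : ℝ)) * g.len y' ^ (-(d : ℝ)) * Real.exp (-(δ₁ / 2 * g.dist y y'))
      = (1 - θ * c)⁻¹ * (A * c) *
          (g.len y ^ (-(4 : ℝ)) * g.len y' ^ (-(d : ℝ)) * Real.exp (-(δ₁ / 2 * g.dist y y'))) := by ring
    _ ≤ 2 * (A * c) * (g.len y ^ (-(4 : ℝ)) * g.len y' ^ (-(d : ℝ)) * Real.exp (-(δ₁ / 2 * g.dist y y'))) :=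
        mul_le_mul_of_nonneg_right (mul_le_mul_of_nonneg_right hinv2 (mul_nonneg hA hc)) hP
    _ = 2 * A * c * g.len y ^ (-(4 : ℝ)) * g.len y' ^ (-(d : ℝ)) * Real.exp (-(δ₁ / 2 * g.dist y y')) := by
        ring

end Assembly

/-! ## §5. Consistency of the hypothesis package: the one-point, one-cube model -/

section NonVacuity

/-- The one-point carrier 𝔅 = {pt} at scale 0 with d ≡ 0, η = L = M = 1, R = 0 (a consistency model only: every
hypothesis of `prop23_assembled` holds on it with □ = h_□ = 1, X = X̃_□ = C_□ = the unit kernel). [folklore] -/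
@[reducible] noncomputable def ptGeo : B6.Geometry where
  Site := Unit
  fin := inferInstance
  scale := fun _ => 0
  dist := fun _ _ => 0
  k := 0
  eta := 1
  L := 1
  R := 0
  M := 1
  Hyp21_22 := True
  Loc := PUnit
  suppIn := fun _ _ => True
  supNorm := fun _ => 0
  l2Norm := fun _ => 0
  holder := fun _ _ => 0
  Cut := PUnit
  cutIn := fun _ _ => True
  cutH := fun _ _ => 0
  cutSup := fun _ => 0

/-- Unfolding: d ≡ 0 on the one-point model. [folklore] -/
@[simp] theorem ptGeo_dist (a b : ptGeo.Site) : ptGeo.dist a b = 0 := rfl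

/-- Unfolding: the scale is 0 on the one-point model. [folklore] -/
@[simp] theorem ptGeo_scale (a : ptGeo.Site) : ptGeo.scale a = 0 := rfl

/-- Unfolding: L = 1 on the one-point model. [folklore] -/
@[simp] theorem ptGeo_L : ptGeo.L = 1 := rfl

/-- Unfolding: M = 1 on the one-point model. [folklore] -/
@[simp] theorem ptGeo_M : ptGeo.M = 1 := rfl

/-- Unfolding: R = 0 on the one-point model. [folklore] -/
@[simp] theorem ptGeo_R : ptGeo.R = 0 := rfl

/-- Unfolding: η = 1 on the one-point model. [folklore] -/
@[simp] theorem ptGeo_eta : ptGeo.eta = 1 := rfl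

/-- L^jη = 1 on the one-point model. [folklore] -/
@[simp] theorem ptGeo_len (a : ptGeo.Site) : ptGeo.len a = 1 := by simp [B6.Geometry.len]

/-- On the one-point carrier every chain of unit kernels is 1. [folklore] -/
theorem ptGeo_chain_one (m : ℕ) (y y' : ptGeo.Site) :
    B6RandomWalk.chain (fun _ _ : ptGeo.Site => (1 : ℝ)) m y y' = 1 := by
  induction m generalizing y with
  | zero => simp
  | succ m ih => simp [B6RandomWalk.chain_succ, ih]

/-- … in particular the (2.63) chains at rate 0. [folklore] -/
theorem ptGeo_chain (m : ℕ) (y y' : ptGeo.Site) :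
    B6RandomWalk.chain (fun a b : ptGeo.Site => Real.exp (-(0 * ptGeo.dist a b))) m y y' = 1 := by
  have hk : (fun a b : ptGeo.Site => Real.exp (-(0 * ptGeo.dist a b))) = fun _ _ => 1 := by
    funext a b; simp
  rw [hk, ptGeo_chain_one]

/-- The constant K of θ ≤ K/M on the one-point model is 1/e. [folklore] -/
theorem ptGeo_K285 (d : ℕ) : K285 ptGeo d 1 0 8 1 1 1 1 0 1 = 1 / Real.exp 1 := by
  unfold K285 kappa2 kappa3 kappa4
  norm_num

/-- «M large enough» on the one-point model: 2K·c = 2/e ≤ 1 = M. [folklore] -/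
theorem ptGeo_threshold (d : ℕ) : 2 * K285 ptGeo d 1 0 8 1 1 1 1 0 1 * 1 ≤ ptGeo.M := by
  have h2e : (2 : ℝ) ≤ Real.exp 1 := by
    have := Real.add_one_le_exp (1 : ℝ); norm_num at this ⊢; linarith
  have he : 0 < Real.exp 1 := Real.exp_pos 1
  rw [ptGeo_K285, ptGeo_M, mul_one, mul_one_div, div_le_iff₀ he]
  linarith

/-- **NON-VACUITY OF `prop23_assembled`**: all its hypotheses hold simultaneously on the one-point model (□ = h_□ = 1,
one cube, unit kernels, δ₀ = 8, δ₁ = σ = s = B_D = 0, c_σ = c = c₃ = m_g = B_X = B_C = 1, n₀ = 1) — the `obtain` line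
below is the theorem applied there with every hypothesis discharged — so the theorem is not an implication from False;
what it yields there: the unit kernel has the inverse G with |G(y, y′)(L^{j′}η)^{−d}| ≤ 2. [folklore] -/
theorem ptGeo_nonvacuous (d : ℕ) :
    ∃ G : Module.End ℝ (ptGeo.Site → ℝ), G * kerOp (fun z => ptGeo.len z ^ d) (fun _ _ => 1) = 1 ∧
      ∀ y y', |mat G y y' / ptGeo.len y' ^ d| ≤ 2 := by
  obtain ⟨G, hGX, -, -, -, hb⟩ :=
    prop23_assembled (g := ptGeo) (D := Unit) d (δ₀ := 8) (δ₁ := 0) (σ := 0) (cσ := 1) (c := 1) (c₃ := 1) (s := 0)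
      (mg := 1) (BX := 1) (BD := 0) (BC := 1) (pf := fun _ _ => 1) (hf := fun _ _ => 1) (js := fun _ => 0) (n₀ := 1)
      (X := fun _ _ => 1) (Xw := fun _ _ _ => 1) (Ck := fun _ _ _ => 1)
      (fun _ _ _ => by simp) (fun _ => rfl) (fun _ _ => le_rfl)
      (fun y y' => by show (0 : ℝ) * 1 * B6Ineq268.mx ptGeo y y' ≤ 0; simp) le_rfl one_pos one_pos
      (by show (0 : ℝ) ≤ 0 * 1; norm_num) (by norm_num) le_rfl (by norm_num) (fun _ => by simp) (by simp)
      (fun _ => by simp) (fun m y y' => by rw [ptGeo_chain]; simp) zero_le_one one_pos le_rfl one_pos zero_le_one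
      le_rfl zero_le_one (fun _ => (Finset.card_filter_le _ _).trans (by simp)) (fun _ _ => Or.inr rfl)
      (fun _ _ => one_mul _) (fun _ => by simp) (fun _ _ _ => by simp) (fun _ _ _ => ⟨le_rfl, by simp⟩)
      (fun _ _ _ _ _ => rfl) (fun _ _ _ h _ => absurd h one_ne_zero) (fun _ _ => by simp) (fun _ _ _ => by simp)
      (fun _ _ _ => by simp) (fun _ _ _ _ _ => by simp) (fun _ _ _ h => absurd h one_ne_zero)
      (fun _ => LinearMap.ext fun μ => funext fun y => by cases y; simp [locOp])
      (ptGeo_threshold d)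
  refine ⟨G, hGX, fun y y' => (hb y y').trans_eq ?_⟩
  simp

end NonVacuity

end Literature.MathematicalPhysics.QuantumFieldTheory.Balaban1983to89.B6Prop23Assembled
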